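import Summits.BirchSwinnertonDyer.BirchSwinnertonDyer.Theses.EdixhovenFibreFiveSeven
import Summits.BirchSwinnertonDyer.BirchSwinnertonDyer.Theorems.EdixhovenFibreFiveSevenStarredOptimalManinUnitFiveSevenAssemblyAt
import Summits.BirchSwinnertonDyer.BirchSwinnertonDyer.Theorems.EdixhovenFibreFiveSevenStarredOptimalManinUnitFiveSevenLeverAtManinUnit57
import Summits.BirchSwinnertonDyer.BirchSwinnertonDyer.Theorems.EdixhovenFibreFiveSevenStarredOptimalManinUnitFiveSevenOrdinaryCellsDeRham
import Summits.BirchSwinnertonDyer.BirchSwinnertonDyer.Theorems.EdixhovenFibreFiveSevenStarredOptimalManinUnitFiveSevenTameTwistLever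
import Summits.BirchSwinnertonDyer.Rank1Residual.Additive.GordTorsionFiveSeven
import Literature.NumberTheory.PAdicHodge.KatoH1BdRFilHolds
import HarnessLib

/-!
# Crux K★ `StarredOptimalManinUnitFiveSeven` (stmt-BirchSwinnertonDyer-22226), line `kato-lever`: the three (G)-ORDINARY
# starred cells GRANTED ONLY {P1, (S5b-tower)} — the de Rham binder hDR DISCHARGED there per curve — and K★ itself GRANTED
# {P1, (S5b-tower), de Rham on the three potentially-SUPERSINGULAR starred cells}

Cell `pub/bsd-wall`, seat `bsd-line-edix-p4` g9 (WIDTH-5, lane (g) of memo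
`Cruxes/StarredOptimalManinUnitFiveSeven/Lines/kato-lever-hDR-programme.md` v3.1 §3). TOOL theorems only (no definition, no named
fact, no `sorry`, no local instance); `--supports` 22226 (helper); nothing is closed; BSD is not proved by any of this.

WHAT. The registered skeleton `Lines/kato_lever.lean` v3 closes K★ from THREE cite-only published facts {P1
`Kato2004.exists_member_sl2ZetaElement_neron_values`, hT₂ `exists_smul_range_expStarCoord_tower_iff_trace_log`, hDR
`isDeRham_restrictedRationalTateRep`} (Kato II Prop. 1.2.3 being the tree theorem
`cupLogInjective_and_hasDualExp_of_isDeRham_holds`). The universal hDR is consumed ONLY at the curve in hand (per-class socket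
`KatoAssemblySocketAt.katoNeronBody_of_sl2NeronValues_of_isDeRhamAt`, per-curve lever `ManinFrameResidueProperRTameTwistAt.*_at`),
and on the (G)-ordinary half of the K★ locus — the Kodaira cells `(5; III*)`, `(7; IV*)`, `(7; II*)`, i.e.
`p = 5 ↔ ord_p Δ_min = 9` (`typeGOrd_iff_of_starred_fiveSeven`) — de Rham-ness of `V_pW|_{Γ_{ℚ_p}}` is the tree THEOREM
`isDeRham_restrictedRationalTateRep_adicCompletion_rat_of_starred_fiveSeven_ordinary` (seat edix-p4 g8, p646133, over
dR-B8 `…_of_potentiallyGoodOrdinary`). Hence: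

* ★ `starredOptimalManinUnit_ordinaryCells_of_sl2NeronValues` — **K★'s conclusion `p ∤ c(D)` on the three (G)-ordinary
  cells GRANTED ONLY P1 and hT₂** (hDR gone from the cone there).
* ★ `starredOptimalManinUnitFiveSeven_of_sl2NeronValues_of_isDeRham_supersingularCells` — **the route decl K★ BY NAME,
  GRANTED P1, hT₂ and the de Rham-ness of `V_pW|_{Γ_{ℚ_v}}` on the complementary cells `(5; IV*)`, `(5; II*)`, `(7; III*)`
  only** (displayed hypothesis `hDRss`, the exact residual de Rham debt of the line: potentially supersingular reduction
  over a ramified tame extension, both `p`-adic periods needed — memo §3 (f)).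
Proof (both): as the skeleton's `StarredOptimalManinUnitFiveSeven_of` — no `p`-torsion in `W(ℚ_p)` on `4 < v_p Δ_min`
(`eq_zero_of_prime_nsmul_eq_zero_of_addv_of_four_le`), `p² ∣ N(W)`, `a_ℓ = ±1` at `ℓ ∥ N(W)` (Kraus–Oesterlé) — then the
per-curve lever `not_dvd_c_of_tameTwist57_at` fed with the per-class socket at `W` and the per-curve de Rham input.
CONDITIONAL on P1 / hT₂ (cite-only, XL); K★ stays OPEN.

References: [Kato2004Asterisque] (8.1.3) p. 180, Thm. 9.7 p. 189, Thm. 6.6 (1) p. 163, Thm. 13.6 p. 227; [Kato1993LNM1553] Ch. II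
Prop. 1.2.3, Ex. 1.3.5, Thm. 1.4.1; [BlochKato1990] Prop. 3.8, Ex. 3.11; [KimNakamura2020] Cor. 2.4; [KostersPannekoek2017] Thm. 1;
[EdixhovenManin1991] Thm. 3; [DokchitserDokchitser2015LocalInvariants] Thm. 3.2; [BrinonConrad2009] Prop. 6.3.8.
-/

set_option autoImplicit false
-- the Theorems namespace of a single-conjunct summit repeats the summit name by design (D-0017)
set_option linter.dupNamespace false

noncomputable section

open scoped Classical MatrixGroups NumberField

open WeierstrassCurve NumberField IsDedekindDomain Field ValuativeRel
  Literature.NumberTheory.EllipticCurves Literature.NumberTheory.EllipticCurves.ModularForms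
  Literature.NumberTheory.EllipticCurves.Rank1Residual Literature.NumberTheory.EllipticCurves.Kato2004
  Literature.NumberTheory.DiophantineGeometry Rat.HeightOneSpectrum
  Literature.NumberTheory.PAdicHodge Literature.NumberTheory.GaloisRepresentations
  Literature.NumberTheory.GaloisRepresentations.IsNonarchimedeanLocalField
  Summit.BirchSwinnertonDyer.Rank1Residual Summit.BirchSwinnertonDyer.Rank1Residual.Additive
  Summit.BirchSwinnertonDyer.BirchSwinnertonDyer.Theorems
  Summit.BirchSwinnertonDyer.BirchSwinnertonDyer.Theorems.KatoAssemblySocketAt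
  Summit.BirchSwinnertonDyer.BirchSwinnertonDyer.Theorems.ManinFrameResidueProperRTameTwistAt
  CongruenceSubgroup Complex

namespace Summit.BirchSwinnertonDyer.BirchSwinnertonDyer.Theorems.StarredOptimalManinUnitFiveSevenCellsOfSL2NeronValues

/-- **K★ on the three (G)-ORDINARY starred cells `(5; III*), (7; IV*), (7; II*)` GRANTED ONLY P1 and (S5b-tower).** For `W/ℚ`
globally minimal, `p ∈ {5, 7}`, additive at `p`, `E[p]` irreducible, no `Iₙ*` fibre at `p`, `4 < ord_p Δ_min`, ON THE HALF
`p = 5 ↔ ord_p Δ_min = 9`, and `D` a lattice-optimal conductor-level datum: `p ∤ c(D)`. The de Rham input of Kato's argument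
is the tree theorem `isDeRham_restrictedRationalTateRep_adicCompletion_rat_of_starred_fiveSeven_ordinary` for THIS `W`; Kato II
Prop. 1.2.3 is the tree theorem `cupLogInjective_and_hasDualExp_of_isDeRham_holds`. CONDITIONAL on the cite-only P1 / hT₂.
[cite: Kato2004Asterisque, (8.1.3) (p. 180), Thm. 9.7 (p. 189)] [cite: KimNakamura2020, Cor. 2.4] [cite: KostersPannekoek2017, Thm. 1]
[cite: DokchitserDokchitser2015LocalInvariants, Thm. 3.2] [cite: Kato1993LNM1553, Ch. II Ex. 1.3.5] -/
theorem starredOptimalManinUnit_ordinaryCells_of_sl2NeronValues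
    (hT₂ : exists_smul_range_expStarCoord_tower_iff_trace_log) (hP1 : exists_member_sl2ZetaElement_neron_values)
    (W : WeierstrassCurve ℚ) [W.IsElliptic] [W.IsGloballyMinimal] (p : ℕ) [Fact p.Prime] {N : ℕ} [NeZero N]
    (D : ModularParametrizationData W N) (hN : N = W.conductorNorm ℤ) (hp57 : p = 5 ∨ p = 7) (hadd : Addv W p) (hirr : Irr W p)
    (hIstar : ∀ (v : HeightOneSpectrum ℤ) (n : ℕ), natGenerator v = p → W.kodairaSymbolAt v ≠ KodairaSymbol.Istar n)
    (h4 : 4 < padicValInt p W.minimalDiscriminantInt) (hord : p = 5 ↔ padicValInt p W.minimalDiscriminantInt = 9)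
    (hopt : ∀ z ∈ D.L.lattice, ∃ w ∈ periodLattice D.f, z = D.c * w) :
    ¬ (p : ℤ) ∣ D.c := by
  subst hN
  have hp5 : 5 ≤ p := by rcases hp57 with rfl | rfl <;> norm_num
  have hPT : ∀ P : (W.baseChange ℚ_[p]).toAffine.Point, p • P = 0 → P = 0 :=
    fun P hP ↦ eq_zero_of_prime_nsmul_eq_zero_of_addv_of_four_le W p hp5 hadd (le_of_lt h4) hP
  have hpN : p ^ 2 ∣ W.conductorNorm ℤ := sq_dvd_conductorNorm_of_not_good_of_not_mult hadd
  have ha : ∀ ℓ ∈ (W.conductorNorm ℤ).primeFactors, ¬ ℓ ^ 2 ∣ W.conductorNorm ℤ →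
      W.LFunction ℓ = 1 ∨ W.LFunction ℓ = -1 := by
    intro ℓ hℓ hℓ2
    haveI : Fact ℓ.Prime := ⟨Nat.prime_of_mem_primeFactors hℓ⟩
    rcases hasGoodReductionAtPrime_or_hasMultiplicativeReductionAtPrime_of_not_sq_dvd_conductorNorm (V := W) hℓ2
      with hg | hmul
    · exact absurd (Nat.dvd_of_mem_primeFactors hℓ) (not_dvd_conductorNorm_of_hasGoodReductionAtPrime W hg)
    · exact KrausOesterle1992.lFunction_apply_prime_eq_one_or_eq_neg_one_of_mult W ℓ hmul
  refine not_dvd_c_of_tameTwist57_at hp57 W ?_ D hopt hPT hadd hirr hpN ha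
  intro M _ g hg hp5' hng hnm hirr' m _ hcop hcl χ hχ hχ1 hord' ϖ r
  refine katoNeronBody_of_sl2NeronValues_of_isDeRhamAt hT₂ cupLogInjective_and_hasDualExp_of_isDeRham_holds hP1 W p
    ?_ g hg hp5' hng hnm hirr' m hcop hcl χ hχ hχ1 hord' ϖ r
  intro v hpv _ _ _ hp' _
  exact isDeRham_restrictedRationalTateRep_adicCompletion_rat_of_starred_fiveSeven_ordinary W p hp57 hadd hIstar h4 hord
    v hpv hp'

/-- **K★ `StarredOptimalManinUnitFiveSeven` BY NAME, GRANTED P1, (S5b-tower) and de Rham-ness of `V_pW|_{Γ_{ℚ_v}}` ON THE THREE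
POTENTIALLY SUPERSINGULAR STARRED CELLS ONLY** (`(5; IV*), (5; II*), (7; III*)`, i.e. `¬ (p = 5 ↔ ord_p Δ_min = 9)`; displayed
hypothesis `hDRss`, in the binder shape of the tree's per-curve de Rham theorems — the exact residual of hDR on this line). On
the (G)-ordinary cells the de Rham input is a tree theorem (`starredOptimalManinUnit_ordinaryCells_of_sl2NeronValues`).
CONDITIONAL; the item is not closed by this. [cite: Kato2004Asterisque, (8.1.3) (p. 180), Thm. 9.7 (p. 189)]
[cite: Kato1993LNM1553, Ch. II Ex. 1.3.5] [cite: KostersPannekoek2017, Thm. 1] [cite: EdixhovenManin1991, Thm. 3] -/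
theorem starredOptimalManinUnitFiveSeven_of_sl2NeronValues_of_isDeRham_supersingularCells
    (hT₂ : exists_smul_range_expStarCoord_tower_iff_trace_log) (hP1 : exists_member_sl2ZetaElement_neron_values)
    (hDRss : ∀ (W : WeierstrassCurve ℚ) [W.IsElliptic] [W.IsGloballyMinimal] (p : ℕ) [Fact p.Prime],
      (p = 5 ∨ p = 7) → Addv W p → Irr W p →
      (∀ (v : HeightOneSpectrum ℤ) (n : ℕ), natGenerator v = p → W.kodairaSymbolAt v ≠ KodairaSymbol.Istar n) →
      4 < padicValInt p W.minimalDiscriminantInt → ¬ (p = 5 ↔ padicValInt p W.minimalDiscriminantInt = 9) →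
      ∀ (v : HeightOneSpectrum (𝓞 ℚ)), ((p : ℕ) : 𝓞 ℚ) ∈ v.asIdeal →
      ∀ [CharZero (v.adicCompletion ℚ)] [Fact (¬ IsUnit (p : integerC (v.adicCompletion ℚ)))]
        [IsAdicComplete (Ideal.span {(p : integerC (v.adicCompletion ℚ))}) (integerC (v.adicCompletion ℚ))]
        (hp' : valuation (v.adicCompletion ℚ) p < 1) [Algebra ℚ_[p] (v.adicCompletion ℚ)],
        GaloisRep.IsDeRham (bdRPeriodRingData (F := v.adicCompletion ℚ) (p := p) hp')
          (restrictedRationalTateRep W (v.adicCompletion ℚ) p)) :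
    Summit.BirchSwinnertonDyer.BirchSwinnertonDyer.Theses.EdixhovenFibreFiveSeven.StarredOptimalManinUnitFiveSeven := by
  intro W _ _ p _ _ D hp57 hadd hirr hIstar h4 hopt
  by_cases hord : (p = 5 ↔ padicValInt p W.minimalDiscriminantInt = 9)
  · exact starredOptimalManinUnit_ordinaryCells_of_sl2NeronValues hT₂ hP1 W p D rfl hp57 hadd hirr hIstar h4 hord hopt
  · have hp5 : 5 ≤ p := by rcases hp57 with rfl | rfl <;> norm_num
    have hPT : ∀ P : (W.baseChange ℚ_[p]).toAffine.Point, p • P = 0 → P = 0 :=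
      fun P hP ↦ eq_zero_of_prime_nsmul_eq_zero_of_addv_of_four_le W p hp5 hadd (le_of_lt h4) hP
    have hpN : p ^ 2 ∣ W.conductorNorm ℤ := sq_dvd_conductorNorm_of_not_good_of_not_mult hadd
    have ha : ∀ ℓ ∈ (W.conductorNorm ℤ).primeFactors, ¬ ℓ ^ 2 ∣ W.conductorNorm ℤ →
        W.LFunction ℓ = 1 ∨ W.LFunction ℓ = -1 := by
      intro ℓ hℓ hℓ2
      haveI : Fact ℓ.Prime := ⟨Nat.prime_of_mem_primeFactors hℓ⟩
      rcases hasGoodReductionAtPrime_or_hasMultiplicativeReductionAtPrime_of_not_sq_dvd_conductorNorm (V := W) hℓ2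
        with hg | hmul
      · exact absurd (Nat.dvd_of_mem_primeFactors hℓ) (not_dvd_conductorNorm_of_hasGoodReductionAtPrime W hg)
      · exact KrausOesterle1992.lFunction_apply_prime_eq_one_or_eq_neg_one_of_mult W ℓ hmul
    refine not_dvd_c_of_tameTwist57_at hp57 W ?_ D hopt hPT hadd hirr hpN ha
    intro M _ g hg hp5' hng hnm hirr' m _ hcop hcl χ hχ hχ1 hord' ϖ r
    refine katoNeronBody_of_sl2NeronValues_of_isDeRhamAt hT₂ cupLogInjective_and_hasDualExp_of_isDeRham_holds hP1 W p
      ?_ g hg hp5' hng hnm hirr' m hcop hcl χ hχ hχ1 hord' ϖ r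
    intro v hpv _ _ _ hp' _
    exact hDRss W p hp57 hadd hirr hIstar h4 hord v hpv hp'

end Summit.BirchSwinnertonDyer.BirchSwinnertonDyer.Theorems.StarredOptimalManinUnitFiveSevenCellsOfSL2NeronValues

end
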